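import Summits.ValiantsHypothesis.ValiantsHypothesis.Theorems.LacunarySymmetroidMatrixDescartesCensusNewtonCone

/-!
# `MatrixDescartes` census — product twists of a fewnomial and LOCATED twisted Rolle (kernel toolkit)

HONEST FRAMING.  Object-search cell `pub-symmetroid`, door-A item `Theses.LacunarySymmetroid.DoorA26 = PosRootLawAt 2 6 19`
(stmt-ValiantsHypothesis-19979; OPEN, typed, never asserted).  Structural lemmas about ONE arbitrary real polynomial, the toolkit
of the END-WINDOW row (`…CensusEndWindow.lean`):

* `coeff_twistSum`, `support_twistSum`, `twistSum_empty`, `twistSum_insert`, `card_posRoots_le_card_posRoots_twistSum` — the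
  product twist `∑_{s ∈ supp f} C(coeff f s · ∏_{u∈W}(s − u)) X^s` (the exponents in `W` killed by Euler twists
  `f ↦ X f′ − u f`) as a polynomial: coefficients, support `supp f ∖ W`, one more twist, and the iterated twisted-Rolle count
  (the tree's `card_posRoots_le_card_posRoots_twists` in support-indexed form).
* `exists_root_gt_of_twist_root` — LOCATED twisted Rolle: for `f` Descartes-sharp on its own support (`#supp f ≤ #Z₊(f) + 1`)
  and `E ∈ supp f`, every positive root of `X f′ − E f` lies strictly below some root of `f` (Rolle interleaves `#Z₊(f) − 1`
  roots of the twist between the roots of `f`, and Descartes' rule leaves the twist — `#supp f − 1` monomials — no other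
  positive root).  Iterated over a set of killed exponents: `exists_root_ge_of_twistSum_root`.
* `exists_root_of_trinomial_pow_gt` — a real trinomial `α X^p + β X^{p+a} + γ X^{p+a+b}` (`γ ≠ 0`) with two distinct
  positive roots has a positive root `τ` with `a|β| < (a+b)|γ| τ^b` (Rolle between the two roots: at the critical point `ξ`
  of `α + β t^a + γ t^{a+b}` one has `(a+b)|γ| ξ^b = a|β|`).

Nothing here bears on `ζ_sym`, on `DoorA26`/`DoorA34` (OPEN), on the crux `MatrixDescartes` (stmt-ValiantsHypothesis-18050) or
on `VP ≠ VNP`.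

[folklore] Rolle's theorem and Descartes' rule of signs (sparse form); elementary.
-/

-- `Summit.ValiantsHypothesis.ValiantsHypothesis.…` repeats a component by the D-0017 layout
-- (single-conjunct summit), which the `dupNamespace` linter flags; the name is mandated.
set_option linter.dupNamespace false

namespace Summit.ValiantsHypothesis.ValiantsHypothesis.Theorems.LacunarySymmetroidMatrixDescartes.Census

open Polynomial Finset
open scoped BigOperators Polynomial

/-! ## The product twist as a polynomial indexed by the support -/

/-- Coefficients of the product twist `∑_{s ∈ supp f} C(coeff f s · ∏_{u ∈ W} (s − u)) · X^s`. [folklore] -/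
theorem coeff_twistSum (f : ℝ[X]) (W : Finset ℕ) (n : ℕ) :
    (∑ s ∈ f.support, C (f.coeff s * ∏ u ∈ W, ((s : ℝ) - u)) * X ^ s).coeff n
      = f.coeff n * ∏ u ∈ W, ((n : ℝ) - u) := by
  rw [finsetSum_coeff]
  simp only [coeff_C_mul, coeff_X_pow, mul_ite, mul_one, mul_zero]
  rw [Finset.sum_ite_eq f.support n]
  split_ifs with h
  · rfl
  · rw [notMem_support_iff.mp h, zero_mul]

/-- The support of the product twist is `supp f` minus the killed exponents. [folklore] -/
theorem support_twistSum (f : ℝ[X]) (W : Finset ℕ) :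
    (∑ s ∈ f.support, C (f.coeff s * ∏ u ∈ W, ((s : ℝ) - u)) * X ^ s).support = f.support \ W := by
  ext n
  rw [mem_support_iff, coeff_twistSum, Finset.mem_sdiff, mem_support_iff, mul_ne_zero_iff,
    Finset.prod_ne_zero_iff]
  constructor
  · rintro ⟨h1, h2⟩
    refine ⟨h1, fun hn => ?_⟩
    exact h2 n hn (sub_self _)
  · rintro ⟨h1, h2⟩
    refine ⟨h1, fun u hu h => h2 ?_⟩
    have : (n : ℝ) = u := sub_eq_zero.mp h
    have hnu : n = u := by exact_mod_cast this
    rwa [hnu]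

/-- The product twist over `∅` is `f` itself. [folklore] -/
theorem twistSum_empty (f : ℝ[X]) :
    (∑ s ∈ f.support, C (f.coeff s * ∏ u ∈ (∅ : Finset ℕ), ((s : ℝ) - u)) * X ^ s) = f := by
  simp only [Finset.prod_empty, mul_one]
  exact f.as_sum_support_C_mul_X_pow.symm

/-- One more Euler twist: killing `w ∉ W` on top of `W` is the twist `X·g′ − w·g` of the `W`-twisted polynomial `g`.
[folklore] -/
theorem twistSum_insert (f : ℝ[X]) (W : Finset ℕ) {w : ℕ} (hw : w ∉ W) :
    (∑ s ∈ f.support, C (f.coeff s * ∏ u ∈ insert w W, ((s : ℝ) - u)) * X ^ s)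
      = X * derivative (∑ s ∈ f.support, C (f.coeff s * ∏ u ∈ W, ((s : ℝ) - u)) * X ^ s)
        - C (w : ℝ) * (∑ s ∈ f.support, C (f.coeff s * ∏ u ∈ W, ((s : ℝ) - u)) * X ^ s) := by
  ext n
  rw [coeff_X_mul_derivative_sub_C_mul, coeff_twistSum, coeff_twistSum, Finset.prod_insert hw]
  ring

/-- **Iterated twisted Rolle, support-indexed form.**  Killing the exponents in `W` by Euler twists loses at most `#W`
distinct positive roots. [folklore] -/
theorem card_posRoots_le_card_posRoots_twistSum (f : ℝ[X]) (W : Finset ℕ) :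
    (f.roots.toFinset.filter (fun x => 0 < x)).card ≤
      ((∑ s ∈ f.support, C (f.coeff s * ∏ u ∈ W, ((s : ℝ) - u)) * X ^ s).roots.toFinset.filter
        (fun x => 0 < x)).card + W.card := by
  induction W using Finset.induction_on with
  | empty => rw [twistSum_empty]; simp
  | insert w W hw ih =>
    rw [Finset.card_insert_of_notMem hw, twistSum_insert f W hw]
    have step := card_posRoots_le_card_posRoots_twist_succ
      (∑ s ∈ f.support, C (f.coeff s * ∏ u ∈ W, ((s : ℝ) - u)) * X ^ s) (w : ℝ)
    omega

/-! ## Located twisted Rolle -/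

/-- **Located twisted Rolle.**  Let `f` be Descartes-sharp on its own support (`#supp f ≤ #Z₊(f) + 1`) with at least two
monomials, and let `E ∈ supp f`.  Then every positive root `x` of the Euler twist `X·f′ − E·f` lies strictly below some root of
`f`.  (Rolle puts a root of the twist strictly between any two consecutive positive roots of `f`; if no root of `f` exceeded
`x`, these `#Z₊(f) − 1` roots would all lie below `x`, and together with `x` the twist — which has `#supp f − 1` monomials —
would have `#Z₊(f) ≥ #supp f − 1` distinct positive roots, contradicting Descartes' rule.) [folklore] -/
theorem exists_root_gt_of_twist_root (f : ℝ[X]) (h2 : 2 ≤ f.support.card)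
    (hZ : f.support.card ≤ (f.roots.toFinset.filter (fun x => 0 < x)).card + 1)
    {E : ℕ} (hE : E ∈ f.support) {x : ℝ} (hx : 0 < x)
    (hroot : (X * derivative f - C (E : ℝ) * f).eval x = 0) :
    ∃ y, x < y ∧ f.eval y = 0 := by
  have hf : f ≠ 0 := by
    intro h; rw [h, support_zero, Finset.card_empty] at h2; omega
  set g : ℝ[X] := X * derivative f - C (E : ℝ) * f with hg_def
  have hgsupp : g.support = f.support.erase E := by
    ext n
    rw [mem_support_iff, hg_def, coeff_X_mul_derivative_sub_C_mul, Finset.mem_erase, mem_support_iff,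
      mul_ne_zero_iff, sub_ne_zero]
    exact and_congr_left fun _ => Nat.cast_injective.ne_iff
  have hgcard : g.support.card + 1 = f.support.card := by
    rw [hgsupp, Finset.card_erase_of_mem hE]; omega
  have hg : g ≠ 0 := by
    intro h; rw [h, support_zero, Finset.card_empty] at hgcard; omega
  by_contra H
  -- every root of `f` is `≤ x`
  have hle : ∀ y, f.eval y = 0 → y ≤ x := fun y hy => by
    by_contra h'; exact H ⟨y, lt_of_not_ge h', hy⟩
  set s := f.roots.toFinset.filter (fun x => 0 < x) with hs_def
  set t := (g.roots.toFinset.filter (fun x => 0 < x)).filter (fun z => z < x) with ht_def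
  -- Rolle between consecutive positive roots of `f`, landing below `x`
  have hst : s.card ≤ t.card + 1 := by
    refine Finset.card_le_of_interleaved fun a ha b hb hab _ => ?_
    simp only [hs_def, Finset.mem_filter, Multiset.mem_toFinset, mem_roots hf, IsRoot.def] at ha hb
    obtain ⟨hfa, ha0⟩ := ha
    obtain ⟨hfb, hb0⟩ := hb
    have hder : ∀ u ∈ Set.Ioo a b, HasDerivAt (fun u => f.eval u * Real.exp (-(E : ℝ) * Real.log u))
        ((derivative f).eval u * Real.exp (-(E : ℝ) * Real.log u) +
          f.eval u * (Real.exp (-(E : ℝ) * Real.log u) * (-(E : ℝ) * u⁻¹))) u := by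
      intro u hu
      have hu0 : u ≠ 0 := (ha0.trans hu.1).ne'
      refine (f.hasDerivAt u).mul ?_
      exact ((Real.hasDerivAt_log hu0).const_mul (-(E : ℝ))).exp
    have hcont : ContinuousOn (fun u => f.eval u * Real.exp (-(E : ℝ) * Real.log u)) (Set.Icc a b) := by
      refine f.continuousOn.mul (Real.continuous_exp.comp_continuousOn
        ((continuousOn_const.mul (Real.continuousOn_log.mono ?_))))
      intro u hu; exact (ha0.trans_le hu.1).ne'
    obtain ⟨z, hz, hz0⟩ := exists_hasDerivAt_eq_zero hab hcont (by simp [hfa, hfb]) hder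
    have hz0' : 0 < z := ha0.trans hz.1
    have hbx : b ≤ x := hle b hfb
    refine ⟨z, ?_, hz.1, hz.2⟩
    have hexp : 0 < Real.exp (-(E : ℝ) * Real.log z) := Real.exp_pos _
    have hzne : z ≠ 0 := hz0'.ne'
    have key : Real.exp (-(E : ℝ) * Real.log z) * (z * (derivative f).eval z - (E : ℝ) * f.eval z)
        = ((derivative f).eval z * Real.exp (-(E : ℝ) * Real.log z) +
            f.eval z * (Real.exp (-(E : ℝ) * Real.log z) * (-(E : ℝ) * z⁻¹))) * z := by
      field_simp
      ring
    rw [hz0, zero_mul] at key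
    have hgz : g.eval z = 0 := by
      rw [hg_def, eval_sub, eval_mul, eval_X, eval_C_mul]
      rcases mul_eq_zero.mp key with h | h
      · exact absurd h hexp.ne'
      · linarith [h]
    simp only [ht_def, Finset.mem_filter, Multiset.mem_toFinset, mem_roots hg, IsRoot.def]
    exact ⟨⟨hgz, hz0'⟩, hz.2.trans_le hbx⟩
  -- `t ∪ {x}` consists of positive roots of `g`
  have hxg : x ∈ g.roots.toFinset.filter (fun x => 0 < x) := by
    simp only [Finset.mem_filter, Multiset.mem_toFinset, mem_roots hg, IsRoot.def]
    exact ⟨hroot, hx⟩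
  have htsub : insert x t ⊆ g.roots.toFinset.filter (fun x => 0 < x) := by
    intro z hz
    rcases Finset.mem_insert.mp hz with rfl | hz
    · exact hxg
    · exact (Finset.mem_filter.mp hz).1
  have hxt : x ∉ t := by
    intro h; exact lt_irrefl x (Finset.mem_filter.mp h).2
  have h3 := Finset.card_le_card htsub
  rw [Finset.card_insert_of_notMem hxt] at h3
  -- Descartes for the twist
  have hD := Literature.Computability.AlgebraicComplexity.card_roots_toFinset_filter_pos_lt_card_support hg
  omega

/-- **Located twisted Rolle, iterated.**  For a Descartes-sharp `f` and a set `W ⊆ supp f` of exponents with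
`#W + 2 ≤ #supp f`, every positive root of the `W`-twisted polynomial lies below (`≤`) some positive root of `f`. [folklore] -/
theorem exists_root_ge_of_twistSum_root (f : ℝ[X])
    (hZ : f.support.card ≤ (f.roots.toFinset.filter (fun x => 0 < x)).card + 1)
    (W : Finset ℕ) (hW : W ⊆ f.support) (hW2 : W.card + 2 ≤ f.support.card) {x : ℝ} (hx : 0 < x)
    (hroot : (∑ s ∈ f.support, C (f.coeff s * ∏ u ∈ W, ((s : ℝ) - u)) * X ^ s).eval x = 0) :
    ∃ y, x ≤ y ∧ 0 < y ∧ f.eval y = 0 := by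
  induction W using Finset.induction_on generalizing x with
  | empty => exact ⟨x, le_rfl, hx, by rwa [twistSum_empty] at hroot⟩
  | insert w W hw ih =>
    rw [twistSum_insert f W hw] at hroot
    set g : ℝ[X] := ∑ s ∈ f.support, C (f.coeff s * ∏ u ∈ W, ((s : ℝ) - u)) * X ^ s with hg_def
    have hWf : W ⊆ f.support := fun u hu => hW (Finset.mem_insert_of_mem hu)
    have hwf : w ∈ f.support := hW (Finset.mem_insert_self w W)
    rw [Finset.card_insert_of_notMem hw] at hW2
    have hgs : g.support = f.support \ W := support_twistSum f W
    have hgcard : g.support.card + W.card = f.support.card := by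
      rw [hgs, Finset.card_sdiff_of_subset hWf]
      have := Finset.card_le_card hWf
      omega
    have hg2 : 2 ≤ g.support.card := by omega
    have hgZ : g.support.card ≤ (g.roots.toFinset.filter (fun x => 0 < x)).card + 1 := by
      have h : (f.roots.toFinset.filter (fun x => 0 < x)).card ≤
          (g.roots.toFinset.filter (fun x => 0 < x)).card + W.card :=
        card_posRoots_le_card_posRoots_twistSum f W
      omega
    have hwg : w ∈ g.support := by
      rw [hgs, Finset.mem_sdiff]; exact ⟨hwf, hw⟩
    obtain ⟨y', hxy', hy'⟩ := exists_root_gt_of_twist_root g hg2 hgZ hwg hx hroot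
    obtain ⟨y, hy'y, hy0, hy⟩ := ih hWf (by omega) (hx.trans hxy') hy'
    exact ⟨y, (hxy'.le).trans hy'y, hy0, hy⟩


/-! ## The trinomial: a root beyond the critical point -/

/-- **Trinomial location.**  If the real trinomial `α X^p + β X^{p+a} + γ X^{p+a+b}` (`a, b ≥ 1`, `γ ≠ 0`) has two distinct
positive roots, then it has a positive root `τ` with `a·|β| < (a+b)·|γ|·τ^b`, i.e. beyond the critical point of
`t ↦ α + β t^a + γ t^{a+b}`.  (Rolle between the two roots `τ₁ < τ₂`: at the critical point `ξ ∈ (τ₁, τ₂)` one has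
`a β + (a+b) γ ξ^b = 0`, so `(a+b)|γ| τ₂^b > (a+b)|γ| ξ^b = a|β|`.) [folklore] -/
theorem exists_root_of_trinomial_pow_gt {p a b : ℕ} (ha : 0 < a) (hb : 0 < b) (α β γ : ℝ) (hγ : γ ≠ 0)
    (h2 : 1 < ((C α * X ^ p + C β * X ^ (p + a) + C γ * X ^ (p + a + b)).roots.toFinset.filter
      (fun x => 0 < x)).card) :
    ∃ τ, 0 < τ ∧ (C α * X ^ p + C β * X ^ (p + a) + C γ * X ^ (p + a + b)).eval τ = 0 ∧
      (a : ℝ) * |β| < ((a : ℝ) + b) * |γ| * τ ^ b := by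
  set V : ℝ[X] := C α * X ^ p + C β * X ^ (p + a) + C γ * X ^ (p + a + b) with hV
  have hV0 : V ≠ 0 := by
    intro h; rw [h, roots_zero, Multiset.toFinset_zero, Finset.filter_empty, Finset.card_empty] at h2; omega
  obtain ⟨t1, ht1, t2, ht2, hne⟩ := Finset.one_lt_card.mp h2
  wlog hlt : t1 < t2 generalizing t1 t2
  · exact this t2 ht2 t1 ht1 hne.symm (lt_of_le_of_ne (not_lt.mp hlt) hne.symm)
  simp only [Finset.mem_filter, Multiset.mem_toFinset, mem_roots hV0, IsRoot.def] at ht1 ht2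
  obtain ⟨hr1, h1pos⟩ := ht1
  obtain ⟨hr2, h2pos⟩ := ht2
  refine ⟨t2, h2pos, hr2, ?_⟩
  by_contra hcon
  have hcon' : ((a : ℝ) + b) * |γ| * t2 ^ b ≤ (a : ℝ) * |β| := not_lt.mp hcon
  -- `W(t) = α + β t^a + γ t^(a+b)` vanishes at `t1` and `t2`
  set W : ℝ[X] := C α + C β * X ^ a + C γ * X ^ (a + b) with hW
  have hVW : ∀ t : ℝ, V.eval t = t ^ p * W.eval t := fun t => by
    simp only [hV, hW, eval_add, eval_mul, eval_C, eval_pow, eval_X]; ring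
  have hW1 : W.eval t1 = 0 := by
    have h := hVW t1; rw [hr1] at h
    rcases mul_eq_zero.mp h.symm with h' | h'
    · exact absurd h' (pow_ne_zero _ h1pos.ne')
    · exact h'
  have hW2 : W.eval t2 = 0 := by
    have h := hVW t2; rw [hr2] at h
    rcases mul_eq_zero.mp h.symm with h' | h'
    · exact absurd h' (pow_ne_zero _ h2pos.ne')
    · exact h'
  obtain ⟨ξ, hξ, hξd⟩ := exists_deriv_eq_zero (f := fun t => W.eval t) hlt W.continuousOn (hW1.trans hW2.symm)
  rw [Polynomial.deriv] at hξd
  have hξ0 : 0 < ξ := h1pos.trans hξ.1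
  have hder : W.derivative.eval ξ = β * a * ξ ^ (a - 1) + γ * ((a : ℝ) + b) * ξ ^ (a + b - 1) := by
    simp only [hW, derivative_add, derivative_C, derivative_C_mul_X_pow, zero_add, eval_add, eval_mul, eval_C,
      eval_pow, eval_X]
    push_cast; ring
  rw [hder] at hξd
  -- multiply by `ξ`: `a β ξ^a + (a+b) γ ξ^(a+b) = 0`, then divide by `ξ^a`
  have h1 : ξ ^ (a - 1) * ξ = ξ ^ a := by
    rw [← pow_succ]; congr 1; omega
  have h2' : ξ ^ (a + b - 1) * ξ = ξ ^ a * ξ ^ b := by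
    rw [← pow_succ, ← pow_add]; congr 1; omega
  have key : ξ ^ a * ((a : ℝ) * β + ((a : ℝ) + b) * γ * ξ ^ b) = 0 := by
    have := congrArg (fun y => y * ξ) hξd
    simp only [zero_mul] at this
    calc ξ ^ a * ((a : ℝ) * β + ((a : ℝ) + b) * γ * ξ ^ b)
        = β * a * (ξ ^ (a - 1) * ξ) + γ * ((a : ℝ) + b) * (ξ ^ (a + b - 1) * ξ) := by rw [h1, h2']; ring
      _ = 0 := by rw [← this]; ring
  have key2 : ((a : ℝ) + b) * γ * ξ ^ b = -((a : ℝ) * β) := by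
    rcases mul_eq_zero.mp key with h | h
    · exact absurd h (pow_ne_zero _ hξ0.ne')
    · linarith
  have habs : ((a : ℝ) + b) * |γ| * ξ ^ b = (a : ℝ) * |β| := by
    have h := congrArg (fun y => |y|) key2
    simp only [abs_neg, abs_mul] at h
    have hab : |((a : ℝ) + b)| = (a : ℝ) + b := abs_of_nonneg (by positivity)
    have haa : |(a : ℝ)| = (a : ℝ) := abs_of_nonneg (by positivity)
    rw [hab, haa, abs_of_nonneg (pow_nonneg hξ0.le _)] at h
    exact h
  have hlt2 : ξ ^ b < t2 ^ b := pow_lt_pow_left₀ hξ.2 hξ0.le hb.ne'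
  have hγpos : 0 < ((a : ℝ) + b) * |γ| := by
    have : 0 < |γ| := abs_pos.mpr hγ
    positivity
  have := mul_lt_mul_of_pos_left hlt2 hγpos
  linarith

end Summit.ValiantsHypothesis.ValiantsHypothesis.Theorems.LacunarySymmetroidMatrixDescartes.Census
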